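import Mathlib.Probability.ProductMeasure
import Literature.MathematicalPhysics.QuantumLattice.SchwartzTensorDensityProofs
import Literature.MathematicalPhysics.QuantumLattice.SchwartzMultilinear
import Literature.MathematicalPhysics.QuantumLattice.SchwartzPartition
import HarnessLib

/-!
# The Schwartz kernel theorem for multilinear forms, I: the local functional of a box

Trunk **T-AQFT** (topic `MathematicalPhysics/QuantumLattice`), families `constructive-qft`,
`crit-ising`; the first of two proofs files of the Schwartz kernel (nuclear) theorem behind the
named fact `Literature.MathematicalPhysics.QuantumLattice.existsUnique_schwingerFamilyOf` (`SchwartzTensor`; Reed–Simon I, Thm V.12;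
OS 1973 §3), in the decomposition of the bridge `Literature.MathematicalPhysics.QuantumLattice.IsOSMeasure.exists_isOSFamily`
(measure-form OS axioms ⇒ distributional OS axioms). The global step and the discharges are in
`SchwartzKernelTheorem`. No named facts are introduced here.

Setting: a finite-dimensional real normed space `E` with linear coordinates `Λ : E ≃L[ℝ] ℝᵐ`, a
complex `n`-linear form `M` on `𝓢(E, ℂ)ⁿ` bounded by a finite family `s` of Schwartz seminorms
(`MultilinearMap.IsBoundedBySeminorms`, file `SchwartzMultilinear`), and nested boxes
`B : BoxData n m` in the block coordinates `Λ(vᵢ)_c` of `v ∈ Eⁿ` (file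
`SchwartzTensorDensityProofs`: outer box `∏ (l_{ic}, u_{ic})`, inner box `∏ [l'_{ic}, u'_{ic}]`,
affine cube coordinates `boxCoord`/`boxShift`, block cutoffs `cutFactorS`, characters
`charFactorS`, box Fourier coefficients `boxCoeff`). Main results:

* `BoxData.boxFunctional`: the **local functional** `T_B : 𝓢(Eⁿ, ℂ) →L[ℂ] ℂ` of `B` and `M`,
  `T_B(F) = ∑_{n ∈ ℤ^{n×m}} cₙ(F) · M(q₁(n), …, qₙ(n))`, where `cₙ(F)` are the Fourier
  coefficients of `F` transported to the unit cube of `ℝ^{n×m}` and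
  `qᵢ(n) = Pᵢ · e_{n⌊i} ∈ 𝓢(E, ℂ)` are the elementary factors of the terms `P · eₙ = ⊗ᵢ qᵢ(n)`
  of the box Fourier expansion (`Pᵢ` the block cutoffs, `e_k` the characters of the block
  `n⌊i ∈ ℤᵐ`, `charFactor_eq`). The series converges absolutely and
  `|T_B(F)| ≤ C · K · q'(F)` for every `M` bounded by `s` with constant `C`, with `K`, `q'`
  depending only on `s` and `B` (`boxFunctional_bound`, `norm_boxFunctional_le`): the Schwartz
  seminorms of the elementary factors grow polynomially in `|n|₁` (`seminorm_charFactorS_le`,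
  Leibniz rule with `‖Dʲ e_n‖ ≤ (2π |n|₁ ‖L‖)ʲ`), while `∑ₙ |cₙ(F)| (1 + |n|₁)ʲ ≤ C_j · q_j(F)`
  for every `j` (`tsum_norm_boxCoeff_mul_pow_le`: Schwartz decay of the Fourier transform
  against the summable weights `∏ (1 + |n_{ic}|)⁻²`, and continuity of `F ↦ 𝓕(F ∘ A⁻¹(· - w))`,
  `cubeFourier`).
* `BoxData.boxFunctional_tensorFin`: **reproduction on tensor products** supported in the inner
  box, `T_B(h₁ ⊗ ⋯ ⊗ hₙ) = M(h₁, …, hₙ)` for continuous `M`. Both sides are the limit over the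
  block-cubes `[-R, R]^{m}`, `R → ∞`, of `M(∑_{k} c_k(h₁) q₁(k), …, ∑_{k} c_k(hₙ) qₙ(k))`: the
  right side by the one-block Fourier expansions `∑_k c_k(hᵢ) qᵢ(k) → hᵢ` in `𝓢(E, ℂ)`
  (`tendsto_sum_blockCoeff_smul`, the engine `tendsto_sum_boxCoeff_smul` of
  `SchwartzFourierDensity` in one block) and continuity of `M`; the left side by multilinearity
  (`MultilinearMap.map_sum_finset`), the factorisation `cₙ(⊗h) = ∏ᵢ c_{n⌊i}(hᵢ)` of the
  coefficients (`boxCoeff_tensorFin`: Fubini on the torus `(ℝ/ℤ)^{n×m} ≅ ((ℝ/ℤ)ᵐ)ⁿ`, the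
  coefficients being those of the periodisations, `mFourierCoeff_perExt`), and the exhaustion of
  `ℤ^{n×m}` by block-cubes (`tendsto_map_piFinset_latticeCube`).

## Sources

The kernel theorem: M. Reed, B. Simon, *Methods of Modern Mathematical Physics I*, §V.3,
Thm V.12 (kernel or nuclear theorem) and Problem 35 of Ch. V (multilinear functionals)
[ReedSimonI1980]. The constructive route through Fourier series in boxes is textbook folklore (an
"elementary proof" of the kernel theorem, cf. Friedlander–Joshi as cited by de Faria–de Melo,
*Mathematical Aspects of Quantum Field Theory* (2010), p. 130, Thm 6.3); the proofs here are
self-contained on top of Mathlib and the tree.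

## Mathlib and Literature

Used from Mathlib: `SchwartzMap.mkCLMtoNormedSpace`, `Seminorm.bound_of_continuous`,
`SchwartzMap.fourierTransformCLM`, `SchwartzMap.compCLMOfContinuousLinearEquiv`,
`SchwartzMap.compSubConstCLM`, `SchwartzMap.one_add_le_sup_seminorm_apply`,
`MultilinearMap.map_sum_finset`, `UnitAddTorus.mFourierCoeff`, `MeasurableEquiv.curry`,
`MeasureTheory.Measure.infinitePi_map_curry`, `MeasureTheory.integral_fintype_prod_eq_prod`. From
the tree: `BoxData`, `boxCoeff`, `toCube`, `perExt`, `mFourierCoeff_perExt`,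
`tendsto_sum_boxCoeff_smul`, `norm_iteratedFDeriv_eChar_affine_le`, `summable_pi_inv_one_add_abs_sq`
(`SchwartzFourierDensity`, `SchwartzTensorDensityProofs`), `latticeCube` (`SchwartzPartition`),
`MultilinearMap.IsBoundedBySeminorms` (`SchwartzMultilinear`). Mathlib has no kernel/nuclear
theorem for `SchwartzMap` at the pin (searched: `nuclear`, `kernel theorem`, tensor products of
`SchwartzMap`).
-/

open scoped SchwartzMap Real FourierTransform Topology
open Filter Set Complex

noncomputable section

namespace Literature.MathematicalPhysics.QuantumLattice

/-! ### A. Blocks: coordinates, characters and seminorm growth of the elementary factors -/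

namespace BoxData

section Blocks

variable {E : Type*} [NormedAddCommGroup E] [NormedSpace ℝ E] [FiniteDimensional ℝ E]
variable {m n : ℕ} (Λ : E ≃L[ℝ] EuclideanSpace ℝ (Fin m)) (B : BoxData n m)

/-- The scaled block coordinates `x ↦ (Λ(x)_c / (u_{ic} - l_{ic}))_c` of the `i`-th block, as a
linear equivalence `E ≃ ℝᵐ`. [folklore] -/
def blockLinear (i : Fin n) : E ≃ₗ[ℝ] EuclideanSpace ℝ (Fin m) where
  toFun x := WithLp.toLp 2 fun c => (Λ x) c / (B.u (i, c) - B.l (i, c))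
  invFun y := Λ.symm (WithLp.toLp 2 fun c => (B.u (i, c) - B.l (i, c)) * y c)
  map_add' x x' := by ext c; simp [add_div]
  map_smul' r x := by ext c; simp [mul_div_assoc]
  left_inv x := by
    have h : (WithLp.toLp 2 fun c => (B.u (i, c) - B.l (i, c)) *
        ((Λ x) c / (B.u (i, c) - B.l (i, c)))) = Λ x := by
      ext c
      have hne : B.u (i, c) - B.l (i, c) ≠ 0 := (sub_pos.2 (B.hlu (i, c))).ne'
      field_simp
    change Λ.symm _ = x
    rw [h, ContinuousLinearEquiv.symm_apply_apply]
  right_inv y := by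
    ext c
    have hne : B.u (i, c) - B.l (i, c) ≠ 0 := (sub_pos.2 (B.hlu (i, c))).ne'
    simp only [PiLp.toLp_apply, ContinuousLinearEquiv.apply_symm_apply]
    field_simp

/-- The scaled block coordinates as a continuous linear equivalence. [folklore] -/
def blockCoord (i : Fin n) : E ≃L[ℝ] EuclideanSpace ℝ (Fin m) :=
  (B.blockLinear Λ i).toContinuousLinearEquiv

/-- The shift of the affine block coordinates. [folklore] -/
def blockShift (i : Fin n) : EuclideanSpace ℝ (Fin m) :=
  WithLp.toLp 2 fun c => -B.l (i, c) / (B.u (i, c) - B.l (i, c))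

/-- The affine block coordinates are `((Λ x)_c - l_{ic}) / (u_{ic} - l_{ic})`. [folklore] -/
theorem blockCoord_add_blockShift_apply (i : Fin n) (x : E) (c : Fin m) :
    (B.blockCoord Λ i x + B.blockShift i) c = ((Λ x) c - B.l (i, c)) / (B.u (i, c) - B.l (i, c)) := by
  simp only [blockCoord, blockShift, LinearEquiv.coe_toContinuousLinearEquiv', PiLp.add_apply]
  change (Λ x) c / (B.u (i, c) - B.l (i, c)) + -B.l (i, c) / (B.u (i, c) - B.l (i, c)) = _
  ring

/-- The affine block coordinates are the blocks of the affine box coordinates. [folklore] -/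
theorem boxCoord_add_boxShift_eq (v : Fin n → E) (ic : Fin n × Fin m) :
    (boxCoord Λ B.l B.u B.hlu v + boxShift B.l B.u) ic =
      (B.blockCoord Λ ic.1 (v ic.1) + B.blockShift ic.1) ic.2 := by
  rw [boxCoord_add_boxShift_apply, blockCoord_add_blockShift_apply]

/-- The `i`-th block `(n_{ic})_c` of a multi-index `n ∈ ℤ^{n × m}`. [folklore] -/
def block (nn : Fin n × Fin m → ℤ) (i : Fin n) : Fin m → ℤ := fun c => nn (i, c)

/-- Unfolding of `block`. [folklore] -/
@[simp]
theorem block_apply (nn : Fin n × Fin m → ℤ) (i : Fin n) (c : Fin m) : block nn i c = nn (i, c) := rfl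

/-- `|n⌊i|₁ ≤ |n|₁`. [folklore] -/
theorem absSum_block_le (nn : Fin n × Fin m → ℤ) (i : Fin n) : absSum (block nn i) ≤ absSum nn := by
  unfold absSum
  rw [Fintype.sum_prod_type (f := fun ic : Fin n × Fin m => |(nn ic : ℝ)|)]
  exact Finset.single_le_sum (f := fun i' => ∑ c, |(nn (i', c) : ℝ)|)
    (fun i' _ => Finset.sum_nonneg fun c _ => abs_nonneg _) (Finset.mem_univ i)

/-- The phase of the `i`-th elementary factor is the integer form of the block, in the affine block
coordinates. [folklore] -/
theorem phase_eq (nn : Fin n × Fin m → ℤ) (i : Fin n) (x : E) :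
    B.phase Λ nn i x = intForm (block nn i) (B.blockCoord Λ i x + B.blockShift i) := by
  rw [intForm_apply, phase]
  refine Finset.sum_congr rfl fun c _ => ?_
  rw [blockCoord_add_blockShift_apply, block_apply]

/-- The `i`-th elementary factor is the block cutoff times the block character. [folklore] -/
theorem charFactor_eq (nn : Fin n × Fin m → ℤ) (i : Fin n) (x : E) :
    B.charFactor Λ nn i x =
      ofRealTest (B.cutFactorS Λ i) x * eChar (block nn i) (B.blockCoord Λ i x + B.blockShift i) := by
  rw [charFactor, eChar, phase_eq, ofRealTest_apply, cutFactorS_apply]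

/-- **Polynomial growth of the Schwartz seminorms of the elementary factors**:
`‖qᵢ(n)‖_{k,l} ≤ K (1 + |n|₁)^l` (Leibniz rule with the block cutoff and `‖Dʲ e_n‖ ≤ (2π|n|₁‖L‖)ʲ`). [folklore] -/
theorem seminorm_charFactorS_le (k l : ℕ) (i : Fin n) :
    ∃ K : ℝ, 0 ≤ K ∧ ∀ nn : Fin n × Fin m → ℤ,
      SchwartzMap.seminorm ℂ k l (B.charFactorS Λ nn i) ≤ K * (1 + absSum nn) ^ l := by
  set P : 𝓢(E, ℂ) := ofRealTest (B.cutFactorS Λ i) with hP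
  set Lc : E →L[ℝ] EuclideanSpace ℝ (Fin m) := (B.blockCoord Λ i : E →L[ℝ] EuclideanSpace ℝ (Fin m))
  set c₀ : ℝ := max (2 * π * ‖Lc‖) 1 with hc₀
  have hc₀1 : 1 ≤ c₀ := le_max_right _ _
  set K : ℝ := ∑ j ∈ Finset.range (l + 1), (l.choose j : ℝ) * SchwartzMap.seminorm ℂ k j P * c₀ ^ l
    with hK
  have hc₀0 : 0 ≤ c₀ := zero_le_one.trans hc₀1
  refine ⟨K, Finset.sum_nonneg fun j _ => mul_nonneg (mul_nonneg (Nat.cast_nonneg _)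
    (apply_nonneg _ _)) (pow_nonneg hc₀0 _), fun nn => ?_⟩
  set a : ℝ := absSum nn with ha
  have ha0 : 0 ≤ a := absSum_nonneg nn
  let T : E → ℂ := fun x => eChar (block nn i) (Lc x + B.blockShift i)
  have hT : ContDiff ℝ (⊤ : ℕ∞) T := contDiff_eChar_affine Lc (B.blockShift i) (block nn i)
  have hε : ∀ j ≤ l, ∀ x, ‖iteratedFDeriv ℝ j T x‖ ≤ (c₀ * a) ^ j := by
    intro j _ x
    refine (norm_iteratedFDeriv_eChar_affine_le Lc (B.blockShift i) (block nn i) j x).trans ?_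
    refine pow_le_pow_left₀ (mul_nonneg (mul_nonneg (by positivity) (absSum_nonneg _))
      (norm_nonneg _)) ?_ j
    calc 2 * π * absSum (block nn i) * ‖Lc‖ = (2 * π * ‖Lc‖) * absSum (block nn i) := by ring
      _ ≤ c₀ * a := mul_le_mul (le_max_left _ _) (absSum_block_le nn i) (absSum_nonneg _)
          (le_trans zero_le_one hc₀1)
  have hfun : (B.charFactorS Λ nn i : E → ℂ) = fun x => P x * T x := funext fun x => by
    rw [charFactorS_apply, charFactor_eq]
    rfl
  have ha1 : 0 ≤ 1 + a := by linarith
  refine SchwartzMap.seminorm_le_bound ℂ k l _ (mul_nonneg (Finset.sum_nonneg fun j _ =>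
    mul_nonneg (mul_nonneg (Nat.cast_nonneg _) (apply_nonneg _ _)) (pow_nonneg hc₀0 _))
    (pow_nonneg ha1 _)) fun x => ?_
  rw [hfun]
  refine (pow_mul_norm_iteratedFDeriv_mul_le P hT hε k x).trans ?_
  rw [hK, Finset.sum_mul]
  refine Finset.sum_le_sum fun j hj => ?_
  have hjl : j ≤ l := Nat.lt_succ_iff.1 (Finset.mem_range.1 hj)
  have h1 : (c₀ * a) ^ (l - j) ≤ c₀ ^ l * (1 + a) ^ l := by
    rw [mul_pow]
    refine mul_le_mul (pow_le_pow_right₀ hc₀1 (Nat.sub_le l j))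
      ((pow_le_pow_left₀ ha0 (by linarith) _).trans (pow_le_pow_right₀ (by linarith) (Nat.sub_le l j)))
      (pow_nonneg ha0 _) (pow_nonneg hc₀0 _)
  calc (l.choose j : ℝ) * SchwartzMap.seminorm ℂ k j P * (c₀ * a) ^ (l - j)
      ≤ (l.choose j : ℝ) * SchwartzMap.seminorm ℂ k j P * (c₀ ^ l * (1 + a) ^ l) :=
        mul_le_mul_of_nonneg_left h1 (mul_nonneg (Nat.cast_nonneg _) (apply_nonneg _ _))
    _ = (l.choose j : ℝ) * SchwartzMap.seminorm ℂ k j P * c₀ ^ l * (1 + a) ^ l := by ring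

/-- Polynomial growth of any finite supremum of Schwartz seminorms of the elementary factors. [folklore] -/
theorem sup_seminorm_charFactorS_le (s : Finset (ℕ × ℕ)) (i : Fin n) :
    ∃ (K : ℝ) (kk : ℕ), 0 ≤ K ∧ ∀ nn : Fin n × Fin m → ℤ,
      (s.sup (schwartzSeminormFamily ℂ E ℂ)) (B.charFactorS Λ nn i) ≤ K * (1 + absSum nn) ^ kk := by
  choose K hK0 hK using fun p : ℕ × ℕ => B.seminorm_charFactorS_le Λ p.1 p.2 i
  refine ⟨∑ p ∈ s, K p, s.sup Prod.snd, Finset.sum_nonneg fun p _ => hK0 p, fun nn => ?_⟩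
  have h1 : (1 : ℝ) ≤ 1 + absSum nn := le_add_of_nonneg_right (absSum_nonneg nn)
  have h0 : (0 : ℝ) ≤ 1 + absSum nn := zero_le_one.trans h1
  refine Seminorm.finset_sup_apply_le (mul_nonneg (Finset.sum_nonneg fun p _ => hK0 p)
    (pow_nonneg h0 _)) fun p hp => ?_
  rw [SchwartzMap.schwartzSeminormFamily_apply]
  calc SchwartzMap.seminorm ℂ p.1 p.2 (B.charFactorS Λ nn i) ≤ K p * (1 + absSum nn) ^ p.2 := hK p nn
    _ ≤ K p * (1 + absSum nn) ^ (s.sup Prod.snd) :=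
        mul_le_mul_of_nonneg_left (pow_le_pow_right₀ h1 (Finset.le_sup (f := Prod.snd) hp)) (hK0 p)
    _ ≤ (∑ p ∈ s, K p) * (1 + absSum nn) ^ (s.sup Prod.snd) :=
        mul_le_mul_of_nonneg_right (Finset.single_le_sum (fun p _ => hK0 p) hp) (pow_nonneg h0 _)

/-- **Polynomial growth of a bounded multilinear form on the elementary factors**, uniformly in
the form: for a finite family `s` of seminorms there are `K, k` with
`‖M(q₁(n), …, qₙ(n))‖ ≤ C K (1 + |n|₁)^k` for every `M` bounded by `s` with constant `C`. [folklore] -/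
theorem norm_multilinear_charFactorS_le (s : Finset (ℕ × ℕ)) :
    ∃ (K : ℝ) (kk : ℕ), 0 ≤ K ∧ ∀ (Mc : MultilinearMap ℂ (fun _ : Fin n => 𝓢(E, ℂ)) ℂ) (C : ℝ),
      Mc.IsBoundedBySeminorms s C → ∀ nn : Fin n × Fin m → ℤ,
        ‖Mc (fun i => B.charFactorS Λ nn i)‖ ≤ C * K * (1 + absSum nn) ^ kk := by
  choose K kk hK0 hK using fun i : Fin n => B.sup_seminorm_charFactorS_le Λ s i
  refine ⟨∏ i, K i, ∑ i, kk i, Finset.prod_nonneg fun i _ => hK0 i, fun Mc C hb nn => ?_⟩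
  refine (hb.2 _).trans ?_
  rw [mul_assoc]
  refine mul_le_mul_of_nonneg_left ?_ hb.1
  rw [← Finset.prod_pow_eq_pow_sum, ← Finset.prod_mul_distrib]
  exact Finset.prod_le_prod (fun i _ => apply_nonneg _ _) fun i _ => hK i nn

end Blocks

end BoxData

/-! ### B. The local functional attached to a box -/

section CoeffBounds

variable {ι : Type*} [Fintype ι]

/-- **Quantitative lattice sums of the Fourier transform**: for every `j` there is `C` such that
`∑_{n ∈ ℤ^ι} |𝓕G(n)| (1 + |n|₁)^j ≤ C · sup_{k ≤ j + 2|ι|} ‖𝓕G‖_{k,0}` for all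
`G ∈ 𝓢(ℝ^ι)` (the summable weights `∏_c (1 + |n_c|)⁻²` against the Schwartz decay of `𝓕G`). [folklore] -/
theorem tsum_norm_fourier_intVec_mul_pow_le (j : ℕ) :
    ∃ C : ℝ, 0 ≤ C ∧ ∀ G : 𝓢(EuclideanSpace ℝ ι, ℂ),
      (Summable fun nn : ι → ℤ => ‖𝓕 (G : EuclideanSpace ℝ ι → ℂ) (intVec nn)‖ * (1 + absSum nn) ^ j) ∧
      ∑' nn : ι → ℤ, ‖𝓕 (G : EuclideanSpace ℝ ι → ℂ) (intVec nn)‖ * (1 + absSum nn) ^ j ≤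
        C * ((Finset.Iic (j + 2 * Fintype.card ι, 0)).sup (schwartzSeminormFamily ℂ _ ℂ)) (𝓕 G) := by
  set M : ℕ := j + 2 * Fintype.card ι with hM
  set cι : ℝ := max (Fintype.card ι : ℝ) 1 with hcι
  set S : ℝ := ∑' nn : ι → ℤ, ∏ c, ((1 + |(nn c : ℝ)|) ^ 2)⁻¹ with hS
  have hSsum := summable_pi_inv_one_add_abs_sq (ι := ι)
  have hS0 : 0 ≤ S := tsum_nonneg fun nn => Finset.prod_nonneg fun c _ => by positivity
  refine ⟨cι ^ j * 2 ^ M * S, by positivity, fun G => ?_⟩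
  set Gh : 𝓢(EuclideanSpace ℝ ι, ℂ) := 𝓕 G with hGh
  have hcoe : (𝓕 (G : EuclideanSpace ℝ ι → ℂ)) = (Gh : EuclideanSpace ℝ ι → ℂ) :=
    (SchwartzMap.fourier_coe G).symm
  set q : ℝ := ((Finset.Iic (M, 0)).sup (schwartzSeminormFamily ℂ _ ℂ)) Gh with hq
  have hq0 : 0 ≤ q := apply_nonneg _ _
  have hdecay : ∀ ξ : EuclideanSpace ℝ ι, (1 + ‖ξ‖) ^ M * ‖Gh ξ‖ ≤ 2 ^ M * q := by
    intro ξ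
    have h := SchwartzMap.one_add_le_sup_seminorm_apply (𝕜 := ℂ) (m := (M, 0)) (k := M) (n := 0)
      le_rfl le_rfl Gh ξ
    rwa [norm_iteratedFDeriv_zero] at h
  -- pointwise bound
  have hpt : ∀ nn : ι → ℤ, ‖Gh (intVec nn)‖ * (1 + absSum nn) ^ j ≤
      (cι ^ j * 2 ^ M * q) * ∏ c, ((1 + |(nn c : ℝ)|) ^ 2)⁻¹ := by
    intro nn
    have hprod_pos : 0 < ∏ c, (1 + |(nn c : ℝ)|) ^ 2 := Finset.prod_pos fun c _ => by positivity
    have h1 : 1 + absSum nn ≤ cι * (1 + ‖intVec nn‖) := by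
      calc 1 + absSum nn ≤ 1 + Fintype.card ι * ‖intVec nn‖ := by
            gcongr; exact absSum_le_card_mul_norm nn
        _ ≤ cι * 1 + cι * ‖intVec nn‖ := by
            gcongr
            · linarith [le_max_right (Fintype.card ι : ℝ) 1]
            · exact le_max_left _ _
        _ = cι * (1 + ‖intVec nn‖) := by ring
    have h2 : (1 + ‖intVec nn‖) ^ j * ‖Gh (intVec nn)‖ * ∏ c, (1 + |(nn c : ℝ)|) ^ 2 ≤ 2 ^ M * q := by
      calc (1 + ‖intVec nn‖) ^ j * ‖Gh (intVec nn)‖ * ∏ c, (1 + |(nn c : ℝ)|) ^ 2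
          ≤ (1 + ‖intVec nn‖) ^ j * ‖Gh (intVec nn)‖ * (1 + ‖intVec nn‖) ^ (2 * Fintype.card ι) := by
            gcongr; exact prod_one_add_abs_sq_le nn
        _ = (1 + ‖intVec nn‖) ^ M * ‖Gh (intVec nn)‖ := by rw [hM, pow_add]; ring
        _ ≤ 2 ^ M * q := hdecay _
    have h3 : (1 + ‖intVec nn‖) ^ j * ‖Gh (intVec nn)‖ ≤ 2 ^ M * q * ∏ c, ((1 + |(nn c : ℝ)|) ^ 2)⁻¹ := by
      rw [Finset.prod_inv_distrib, ← div_eq_mul_inv, le_div_iff₀ hprod_pos]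
      exact h2
    have ha0 : 0 ≤ 1 + absSum nn := add_nonneg zero_le_one (absSum_nonneg nn)
    calc ‖Gh (intVec nn)‖ * (1 + absSum nn) ^ j
        ≤ ‖Gh (intVec nn)‖ * (cι * (1 + ‖intVec nn‖)) ^ j :=
          mul_le_mul_of_nonneg_left (pow_le_pow_left₀ ha0 h1 j) (norm_nonneg _)
      _ = cι ^ j * ((1 + ‖intVec nn‖) ^ j * ‖Gh (intVec nn)‖) := by rw [mul_pow]; ring
      _ ≤ cι ^ j * (2 ^ M * q * ∏ c, ((1 + |(nn c : ℝ)|) ^ 2)⁻¹) := by gcongr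
      _ = (cι ^ j * 2 ^ M * q) * ∏ c, ((1 + |(nn c : ℝ)|) ^ 2)⁻¹ := by ring
  rw [hcoe]
  have hsum : Summable fun nn : ι → ℤ => ‖Gh (intVec nn)‖ * (1 + absSum nn) ^ j :=
    Summable.of_nonneg_of_le (fun nn => mul_nonneg (norm_nonneg _)
      (pow_nonneg (add_nonneg zero_le_one (absSum_nonneg nn)) _)) hpt (hSsum.mul_left _)
  refine ⟨hsum, ?_⟩
  calc ∑' nn : ι → ℤ, ‖Gh (intVec nn)‖ * (1 + absSum nn) ^ j
      ≤ ∑' nn : ι → ℤ, (cι ^ j * 2 ^ M * q) * ∏ c, ((1 + |(nn c : ℝ)|) ^ 2)⁻¹ :=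
        hsum.tsum_le_tsum hpt (hSsum.mul_left _)
    _ = (cι ^ j * 2 ^ M * q) * S := by rw [tsum_mul_left]
    _ = cι ^ j * 2 ^ M * S * q := by ring

end CoeffBounds

section Local

variable {E : Type*} [NormedAddCommGroup E] [NormedSpace ℝ E] [FiniteDimensional ℝ E]
variable {m n : ℕ} (Λ : E ≃L[ℝ] EuclideanSpace ℝ (Fin m)) (B : BoxData n m)

namespace BoxData

/-- The map `F ↦ 𝓕(F ∘ (A⁻¹(· - w)))` sending a test function on `Eⁿ` to the Fourier transform of
its transport to the unit cube of `ℝ^{n × m}` (whose values at lattice points are the box Fourier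
coefficients `boxCoeff`), as a continuous linear map. [folklore] -/
def cubeFourier : 𝓢((Fin n → E), ℂ) →L[ℂ] 𝓢(EuclideanSpace ℝ (Fin n × Fin m), ℂ) :=
  (SchwartzMap.fourierTransformCLM ℂ).comp
    ((SchwartzMap.compSubConstCLM ℂ (boxShift B.l B.u)).comp
      (SchwartzMap.compCLMOfContinuousLinearEquiv ℂ (boxCoord Λ B.l B.u B.hlu).symm))

/-- The values of `cubeFourier F` at the lattice points are the box Fourier coefficients. [folklore] -/
theorem cubeFourier_apply_intVec (F : 𝓢((Fin n → E), ℂ)) (nn : Fin n × Fin m → ℤ) :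
    B.cubeFourier Λ F (intVec nn) = boxCoeff (boxCoord Λ B.l B.u B.hlu) (boxShift B.l B.u) F nn := by
  rw [boxCoeff, cubeFourier]
  simp only [ContinuousLinearMap.coe_comp, Function.comp_apply, SchwartzMap.fourierTransformCLM_apply]
  rw [SchwartzMap.fourier_coe]
  rfl

/-- `cubeFourier F` is the Fourier transform of the transport of `F` to the unit cube. [folklore] -/
theorem fourier_toCube_eq (F : 𝓢((Fin n → E), ℂ)) :
    𝓕 (toCube (boxCoord Λ B.l B.u B.hlu) (boxShift B.l B.u) F) = B.cubeFourier Λ F := by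
  rfl

/-- **Quantitative coefficient bound**: `∑ₙ |cₙ(F)| (1 + |n|₁)^j ≤ C · q(F)` for a finite supremum
`q` of Schwartz seminorms of `F` (Schwartz decay of the Fourier transform, and continuity of
`F ↦ 𝓕(F ∘ (A⁻¹(· - w)))`). [folklore] -/
theorem tsum_norm_boxCoeff_mul_pow_le (j : ℕ) :
    ∃ (s : Finset (ℕ × ℕ)) (C : ℝ), 0 ≤ C ∧ ∀ F : 𝓢((Fin n → E), ℂ),
      (Summable fun nn : Fin n × Fin m → ℤ =>
        ‖boxCoeff (boxCoord Λ B.l B.u B.hlu) (boxShift B.l B.u) F nn‖ * (1 + absSum nn) ^ j) ∧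
      ∑' nn : Fin n × Fin m → ℤ,
        ‖boxCoeff (boxCoord Λ B.l B.u B.hlu) (boxShift B.l B.u) F nn‖ * (1 + absSum nn) ^ j ≤
          C * (s.sup (schwartzSeminormFamily ℂ (Fin n → E) ℂ)) F := by
  obtain ⟨C₁, hC₁, h₁⟩ := tsum_norm_fourier_intVec_mul_pow_le (ι := Fin n × Fin m) j
  -- continuity of the composite seminorm
  set q₀ : Seminorm ℂ 𝓢(EuclideanSpace ℝ (Fin n × Fin m), ℂ) :=
    (Finset.Iic (j + 2 * Fintype.card (Fin n × Fin m), 0)).sup (schwartzSeminormFamily ℂ _ ℂ) with hq₀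
  set q : Seminorm ℂ 𝓢((Fin n → E), ℂ) := q₀.comp (B.cubeFourier Λ).toLinearMap with hq
  have hqc : Continuous q := by
    change Continuous fun F => q₀ (B.cubeFourier Λ F)
    have hq₀c : Continuous q₀ :=
      Seminorm.continuous_finsetSup fun i _ => (schwartz_withSeminorms ℂ _ ℂ).continuous_seminorm i
    exact hq₀c.comp (B.cubeFourier Λ).continuous
  obtain ⟨s, C₂, hC₂, hle⟩ := Seminorm.bound_of_continuous (schwartz_withSeminorms ℂ (Fin n → E) ℂ) q hqc
  refine ⟨s, C₁ * C₂, mul_nonneg hC₁ C₂.coe_nonneg, fun F => ?_⟩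
  obtain ⟨hsum, hb⟩ := h₁ (toCube (boxCoord Λ B.l B.u B.hlu) (boxShift B.l B.u) F)
  refine ⟨hsum, hb.trans ?_⟩
  rw [mul_assoc]
  refine mul_le_mul_of_nonneg_left ?_ hC₁
  have h := hle F
  simp only [smul_apply, NNReal.smul_def, smul_eq_mul] at h
  exact h

/-- The terms `cₙ(F) M(q₁(n), …, qₙ(n))` of the local functional. [folklore] -/
def boxTerm (Mc : MultilinearMap ℂ (fun _ : Fin n => 𝓢(E, ℂ)) ℂ) (F : 𝓢((Fin n → E), ℂ))
    (nn : Fin n × Fin m → ℤ) : ℂ :=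
  boxCoeff (boxCoord Λ B.l B.u B.hlu) (boxShift B.l B.u) F nn * Mc (fun i => B.charFactorS Λ nn i)

/-- The **local functional** attached to a box `B` and a complex multilinear form `M`:
`T_B(F) = ∑_{n ∈ ℤ^{n×m}} cₙ(F) M(q₁(n), …, qₙ(n))`, where `cₙ(F)` are the box Fourier
coefficients of `F` and `qᵢ(n) = Pᵢ e_{n⌊i}` the elementary factors of the term `P eₙ = ⊗ᵢ qᵢ(n)`
of the Fourier expansion. For `F` supported in the inner box, `∑ₙ cₙ(F) ⊗ᵢ qᵢ(n) → F`
(`tendsto_sum_boxCoeff_smul`), so `T_B` is "`M` applied slotwise to the Fourier expansion of `F`".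
(As a bare function; it is a continuous linear functional, `boxFunctional`.) [folklore] -/
def boxFunctionalFun (Mc : MultilinearMap ℂ (fun _ : Fin n => 𝓢(E, ℂ)) ℂ) (F : 𝓢((Fin n → E), ℂ)) : ℂ :=
  ∑' nn : Fin n × Fin m → ℤ, B.boxTerm Λ Mc F nn

/-- **Uniform summability and bound of the local functional**: for a finite family `s` of
seminorms there are `s', K` with `∑ₙ |cₙ(F) M(q(n))| ≤ C K sup_{s'} ‖F‖` for every `M` bounded by
`s` with constant `C` and every `F`. [folklore] -/
theorem boxFunctional_bound (s : Finset (ℕ × ℕ)) :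
    ∃ (s' : Finset (ℕ × ℕ)) (K : ℝ), 0 ≤ K ∧
      ∀ (Mc : MultilinearMap ℂ (fun _ : Fin n => 𝓢(E, ℂ)) ℂ) (C : ℝ), Mc.IsBoundedBySeminorms s C →
        ∀ F : 𝓢((Fin n → E), ℂ),
          (Summable fun nn : Fin n × Fin m → ℤ => ‖B.boxTerm Λ Mc F nn‖) ∧
            ∑' nn : Fin n × Fin m → ℤ, ‖B.boxTerm Λ Mc F nn‖ ≤
              C * K * (s'.sup (schwartzSeminormFamily ℂ (Fin n → E) ℂ)) F := by
  obtain ⟨KM, kk, hKM, hM⟩ := B.norm_multilinear_charFactorS_le Λ s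
  obtain ⟨s', C', hC', hF⟩ := B.tsum_norm_boxCoeff_mul_pow_le Λ kk
  refine ⟨s', KM * C', mul_nonneg hKM hC', fun Mc C hb F => ?_⟩
  obtain ⟨hsum, hbd⟩ := hF F
  have hC : 0 ≤ C := hb.1
  have hpt : ∀ nn : Fin n × Fin m → ℤ, ‖B.boxTerm Λ Mc F nn‖ ≤
      (C * KM) * (‖boxCoeff (boxCoord Λ B.l B.u B.hlu) (boxShift B.l B.u) F nn‖ * (1 + absSum nn) ^ kk) := by
    intro nn
    rw [boxTerm, norm_mul]
    calc _ ≤ ‖boxCoeff (boxCoord Λ B.l B.u B.hlu) (boxShift B.l B.u) F nn‖ * (C * KM * (1 + absSum nn) ^ kk) :=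
          mul_le_mul_of_nonneg_left (hM Mc C hb nn) (norm_nonneg _)
      _ = _ := by ring
  have hsum' : Summable fun nn : Fin n × Fin m → ℤ => ‖B.boxTerm Λ Mc F nn‖ :=
    Summable.of_nonneg_of_le (fun nn => norm_nonneg _) hpt (hsum.mul_left _)
  refine ⟨hsum', ?_⟩
  calc _ ≤ ∑' nn : Fin n × Fin m → ℤ,
        (C * KM) * (‖boxCoeff (boxCoord Λ B.l B.u B.hlu) (boxShift B.l B.u) F nn‖ * (1 + absSum nn) ^ kk) :=
        hsum'.tsum_le_tsum hpt (hsum.mul_left _)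
    _ = (C * KM) * ∑' nn : Fin n × Fin m → ℤ,
        ‖boxCoeff (boxCoord Λ B.l B.u B.hlu) (boxShift B.l B.u) F nn‖ * (1 + absSum nn) ^ kk := tsum_mul_left
    _ ≤ (C * KM) * (C' * (s'.sup (schwartzSeminormFamily ℂ (Fin n → E) ℂ)) F) :=
        mul_le_mul_of_nonneg_left hbd (mul_nonneg hC hKM)
    _ = C * (KM * C') * (s'.sup (schwartzSeminormFamily ℂ (Fin n → E) ℂ)) F := by ring

/-- The finite family of seminorms controlling the local functionals of the forms bounded by `s`
(chosen from `boxFunctional_bound`). [folklore] -/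
def bfSet (s : Finset (ℕ × ℕ)) : Finset (ℕ × ℕ) := (B.boxFunctional_bound Λ s).choose

/-- The constant controlling the local functionals of the forms bounded by `s`
(chosen from `boxFunctional_bound`). [folklore] -/
def bfConst (s : Finset (ℕ × ℕ)) : ℝ := (B.boxFunctional_bound Λ s).choose_spec.choose

/-- `bfConst ≥ 0`. [folklore] -/
theorem bfConst_nonneg (s : Finset (ℕ × ℕ)) : 0 ≤ B.bfConst Λ s :=
  (B.boxFunctional_bound Λ s).choose_spec.choose_spec.1

/-- The defining property of `bfSet`, `bfConst`. [folklore] -/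
theorem bfSet_spec {s : Finset (ℕ × ℕ)} {Mc : MultilinearMap ℂ (fun _ : Fin n => 𝓢(E, ℂ)) ℂ} {C : ℝ}
    (hb : Mc.IsBoundedBySeminorms s C) (F : 𝓢((Fin n → E), ℂ)) :
    (Summable fun nn : Fin n × Fin m → ℤ => ‖B.boxTerm Λ Mc F nn‖) ∧
      ∑' nn : Fin n × Fin m → ℤ, ‖B.boxTerm Λ Mc F nn‖ ≤
        C * B.bfConst Λ s * ((B.bfSet Λ s).sup (schwartzSeminormFamily ℂ (Fin n → E) ℂ)) F :=
  (B.boxFunctional_bound Λ s).choose_spec.choose_spec.2 Mc C hb F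

/-- The box Fourier coefficients depend additively on the function. [folklore] -/
theorem boxCoeff_add (F G : 𝓢((Fin n → E), ℂ)) (nn : Fin n × Fin m → ℤ) :
    boxCoeff (boxCoord Λ B.l B.u B.hlu) (boxShift B.l B.u) (F + G) nn =
      boxCoeff (boxCoord Λ B.l B.u B.hlu) (boxShift B.l B.u) F nn +
        boxCoeff (boxCoord Λ B.l B.u B.hlu) (boxShift B.l B.u) G nn := by
  simp only [← cubeFourier_apply_intVec, map_add, add_apply]

/-- The box Fourier coefficients depend homogeneously on the function. [folklore] -/
theorem boxCoeff_smul (a : ℂ) (F : 𝓢((Fin n → E), ℂ)) (nn : Fin n × Fin m → ℤ) :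
    boxCoeff (boxCoord Λ B.l B.u B.hlu) (boxShift B.l B.u) (a • F) nn =
      a * boxCoeff (boxCoord Λ B.l B.u B.hlu) (boxShift B.l B.u) F nn := by
  simp only [← cubeFourier_apply_intVec, map_smul, smul_apply, smul_eq_mul]

/-- The **local functional** `T_B` attached to a box and a bounded complex multilinear form, as a
continuous linear functional on `𝓢(Eⁿ, ℂ)` (`SchwartzMap.mkCLMtoNormedSpace` with the bound
`|T_B(F)| ≤ C K q(F)` of `boxFunctional_bound`). [folklore] -/
def boxFunctional {s : Finset (ℕ × ℕ)} {Mc : MultilinearMap ℂ (fun _ : Fin n => 𝓢(E, ℂ)) ℂ} {C : ℝ}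
    (hb : Mc.IsBoundedBySeminorms s C) : 𝓢((Fin n → E), ℂ) →L[ℂ] ℂ :=
  SchwartzMap.mkCLMtoNormedSpace (B.boxFunctionalFun Λ Mc)
    (fun F G => by
      unfold boxFunctionalFun
      rw [← (B.bfSet_spec Λ hb F).1.of_norm.tsum_add (B.bfSet_spec Λ hb G).1.of_norm]
      exact tsum_congr fun nn => by rw [boxTerm, boxTerm, boxTerm, boxCoeff_add, add_mul])
    (fun a F => by
      unfold boxFunctionalFun
      rw [smul_eq_mul, ← tsum_mul_left]
      exact tsum_congr fun nn => by rw [boxTerm, boxTerm, boxCoeff_smul, mul_assoc]; rfl)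
    ⟨B.bfSet Λ s, C * B.bfConst Λ s, mul_nonneg hb.1 (B.bfConst_nonneg Λ s), fun F =>
      (norm_tsum_le_tsum_norm (B.bfSet_spec Λ hb F).1).trans (B.bfSet_spec Λ hb F).2⟩

/-- Unfolding of `boxFunctional`. [folklore] -/
theorem boxFunctional_apply {s : Finset (ℕ × ℕ)} {Mc : MultilinearMap ℂ (fun _ : Fin n => 𝓢(E, ℂ)) ℂ}
    {C : ℝ} (hb : Mc.IsBoundedBySeminorms s C) (F : 𝓢((Fin n → E), ℂ)) :
    B.boxFunctional Λ hb F = B.boxFunctionalFun Λ Mc F := rfl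

/-- **Uniform bound of the local functional**: `|T_B(F)| ≤ C · bfConst s · sup_{bfSet s} ‖F‖` for
every form bounded by `s` with constant `C`. [folklore] -/
theorem norm_boxFunctional_le {s : Finset (ℕ × ℕ)} {Mc : MultilinearMap ℂ (fun _ : Fin n => 𝓢(E, ℂ)) ℂ}
    {C : ℝ} (hb : Mc.IsBoundedBySeminorms s C) (F : 𝓢((Fin n → E), ℂ)) :
    ‖B.boxFunctional Λ hb F‖ ≤
      C * B.bfConst Λ s * ((B.bfSet Λ s).sup (schwartzSeminormFamily ℂ (Fin n → E) ℂ)) F :=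
  (norm_tsum_le_tsum_norm (B.bfSet_spec Λ hb F).1).trans (B.bfSet_spec Λ hb F).2

/-- The local functional is the sum of its series (a `HasSum` statement, for taking limits along
finite sets of multi-indices). [folklore] -/
theorem hasSum_boxFunctional {s : Finset (ℕ × ℕ)} {Mc : MultilinearMap ℂ (fun _ : Fin n => 𝓢(E, ℂ)) ℂ}
    {C : ℝ} (hb : Mc.IsBoundedBySeminorms s C) (F : 𝓢((Fin n → E), ℂ)) :
    HasSum (fun nn : Fin n × Fin m → ℤ => B.boxTerm Λ Mc F nn) (B.boxFunctional Λ hb F) :=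
  (B.bfSet_spec Λ hb F).1.of_norm.hasSum

end BoxData

end Local

/-! ### C. Reproduction on tensor products supported in the inner box -/

section Repr

open MeasureTheory

variable {E : Type*} [NormedAddCommGroup E] [NormedSpace ℝ E] [FiniteDimensional ℝ E]
variable {m n : ℕ} (Λ : E ≃L[ℝ] EuclideanSpace ℝ (Fin m)) (B : BoxData n m)

namespace BoxData

/-- The multi-index with `i`-th block `k` and all other blocks `0`. [folklore] -/
def blockIdx (i : Fin n) (k : Fin m → ℤ) : Fin n × Fin m → ℤ := fun ic => if ic.1 = i then k ic.2 else 0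

omit [FiniteDimensional ℝ E] in
/-- The `i`-th block of `blockIdx i k` is `k`. [folklore] -/
@[simp]
theorem block_blockIdx (i : Fin n) (k : Fin m → ℤ) : block (blockIdx i k) i = k := by
  funext c; simp [block, blockIdx]

/-- Uncurrying of block multi-indices, `(Fin n → ℤᵐ) ≃ ℤ^{n × m}`. [folklore] -/
def nnEquiv (n m : ℕ) : (Fin n → Fin m → ℤ) ≃ (Fin n × Fin m → ℤ) := (Equiv.curry (Fin n) (Fin m) ℤ).symm

/-- `nnEquiv r (i, c) = r i c`. [folklore] -/
@[simp]
theorem nnEquiv_apply (r : Fin n → Fin m → ℤ) (ic : Fin n × Fin m) : nnEquiv n m r ic = r ic.1 ic.2 := rfl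

/-- The blocks of `nnEquiv r` are the `r i`. [folklore] -/
@[simp]
theorem block_nnEquiv (r : Fin n → Fin m → ℤ) (i : Fin n) : block (nnEquiv n m r) i = r i := rfl

/-- The elementary factor `qᵢ(n)` only depends on the `i`-th block of `n`. [folklore] -/
theorem charFactorS_congr {nn nn' : Fin n × Fin m → ℤ} {i : Fin n} (h : block nn i = block nn' i) :
    B.charFactorS Λ nn i = B.charFactorS Λ nn' i := by
  ext x
  rw [charFactorS_apply, charFactorS_apply, charFactor_eq, charFactor_eq, h]

/-- **One-block Fourier expansion**: for `g ∈ 𝓢(E, ℂ)` supported in the `i`-th inner block,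
`∑_{k ∈ S} c_k(g) qᵢ(k) → g` in `𝓢(E, ℂ)` as `S ↑ ℤᵐ`, with the block coefficients
`c_k(g) = boxCoeff (blockCoord i) (blockShift i) g k` (the engine `tendsto_sum_boxCoeff_smul` in one
block). [folklore] -/
theorem tendsto_sum_blockCoeff_smul (i : Fin n) (g : 𝓢(E, ℂ))
    (hg : tsupport (g : E → ℂ) ⊆ {x | ∀ c, (Λ x) c ∈ Icc (B.l' (i, c)) (B.u' (i, c))}) :
    Tendsto (fun S : Finset (Fin m → ℤ) => ∑ k ∈ S,
      boxCoeff (B.blockCoord Λ i) (B.blockShift i) g k • B.charFactorS Λ (blockIdx i k) i) atTop (𝓝 g) := by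
  obtain ⟨δ, hδ, hδ1, hδ2⟩ := B.exists_margin
  refine tendsto_sum_boxCoeff_smul (B.blockCoord Λ i) (B.blockShift i) hδ g
    (ofRealTest (B.cutFactorS Λ i)) ?_ ?_ ?_ _ ?_
  · intro v hv c
    rw [blockCoord_add_blockShift_apply]
    exact div_mem_Icc_of_margin (B.hlu (i, c)) (hδ1 (i, c)) (hδ2 (i, c)) (hg hv c)
  · intro v hv
    rw [ofRealTest_apply, cutFactorS_apply, B.cutFactor_eq_one Λ (fun c => hg hv c), Complex.ofReal_one]
  · intro v hv c
    rw [blockCoord_add_blockShift_apply]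
    have hcoe : (ofRealTest (B.cutFactorS Λ i) : E → ℂ) = (fun r : ℝ => (r : ℂ)) ∘ B.cutFactor Λ i := rfl
    rw [hcoe] at hv
    have hv' : v ∈ tsupport (B.cutFactor Λ i) :=
      tsupport_comp_subset (g := fun r : ℝ => (r : ℂ)) Complex.ofReal_zero _ hv
    exact div_mem_Icc_zero_one (B.hlu (i, c))
      (B.K_subset_Icc (i, c) (B.tsupport_cutFactor_subset Λ i hv' c))
  · intro k v
    rw [charFactorS_apply, charFactor_eq, block_blockIdx]

/-- The transport of a test function supported in the inner box to the unit cube vanishes near the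
boundary of the cube (with the margin `δ` of `exists_margin`). [folklore] -/
theorem toCube_eq_zero_near_boundary {δ : ℝ} (hδ1 : ∀ ic, δ * (B.u ic - B.l ic) ≤ B.l' ic - B.l ic)
    (hδ2 : ∀ ic, δ * (B.u ic - B.l ic) ≤ B.u ic - B.u' ic) (F : 𝓢((Fin n → E), ℂ))
    (hF : tsupport (F : (Fin n → E) → ℂ) ⊆
      {v | ∀ ic : Fin n × Fin m, (Λ (v ic.1)) ic.2 ∈ Icc (B.l' ic) (B.u' ic)})
    (y : EuclideanSpace ℝ (Fin n × Fin m)) (hy : ∃ ic, y ic < δ ∨ 1 - δ < y ic) :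
    toCube (boxCoord Λ B.l B.u B.hlu) (boxShift B.l B.u) F y = 0 := by
  rw [toCube_apply]
  by_contra hne
  obtain ⟨ic, hic⟩ := hy
  have hv := hF (subset_tsupport _ hne) ic
  have h := div_mem_Icc_of_margin (B.hlu ic) (hδ1 ic) (hδ2 ic) hv
  rw [← boxCoord_add_boxShift_apply Λ B.l B.u B.hlu] at h
  simp only [ContinuousLinearEquiv.apply_symm_apply, sub_add_cancel, Set.mem_Icc] at h
  rcases hic with hic | hic <;> linarith [h.1, h.2]

/-- One-block version of `toCube_eq_zero_near_boundary`. [folklore] -/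
theorem toCube_block_eq_zero_near_boundary {δ : ℝ} (hδ1 : ∀ ic, δ * (B.u ic - B.l ic) ≤ B.l' ic - B.l ic)
    (hδ2 : ∀ ic, δ * (B.u ic - B.l ic) ≤ B.u ic - B.u' ic) (i : Fin n) (g : 𝓢(E, ℂ))
    (hg : tsupport (g : E → ℂ) ⊆ {x | ∀ c, (Λ x) c ∈ Icc (B.l' (i, c)) (B.u' (i, c))})
    (z : EuclideanSpace ℝ (Fin m)) (hz : ∃ c, z c < δ ∨ 1 - δ < z c) :
    toCube (B.blockCoord Λ i) (B.blockShift i) g z = 0 := by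
  rw [toCube_apply]
  by_contra hne
  obtain ⟨c, hc⟩ := hz
  have hv := hg (subset_tsupport _ hne) c
  have h := div_mem_Icc_of_margin (B.hlu (i, c)) (hδ1 (i, c)) (hδ2 (i, c)) hv
  rw [← blockCoord_add_blockShift_apply] at h
  simp only [ContinuousLinearEquiv.apply_symm_apply, sub_add_cancel, Set.mem_Icc] at h
  rcases hc with hc | hc <;> linarith [h.1, h.2]

/-- The inverse box coordinates act blockwise through the inverse block coordinates. [folklore] -/
theorem boxCoord_symm_apply (y : EuclideanSpace ℝ (Fin n × Fin m)) (i : Fin n) :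
    (boxCoord Λ B.l B.u B.hlu).symm y i =
      (B.blockCoord Λ i).symm (WithLp.toLp 2 fun c => y (i, c)) := rfl

/-- The box shift is the block shift, blockwise. [folklore] -/
theorem boxShift_apply_eq (ic : Fin n × Fin m) : boxShift B.l B.u ic = B.blockShift ic.1 ic.2 := rfl

/-- The tensor product of block functions, transported to the cube, is the product of the
transported block functions. [folklore] -/
theorem toCube_tensorFin_apply (h : Fin n → 𝓢(E, ℂ)) (y : EuclideanSpace ℝ (Fin n × Fin m)) :
    toCube (boxCoord Λ B.l B.u B.hlu) (boxShift B.l B.u) (SchwartzMap.tensorFin n h) y =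
      ∏ i, toCube (B.blockCoord Λ i) (B.blockShift i) (h i) (WithLp.toLp 2 fun c => y (i, c)) := by
  rw [toCube_apply, SchwartzMap.tensorFin_apply]
  refine Finset.prod_congr rfl fun i _ => ?_
  rw [toCube_apply, boxCoord_symm_apply]
  rfl

/-- **Factorisation of the box Fourier coefficients of a tensor product**:
`c_n(h₁ ⊗ ⋯ ⊗ hₙ) = ∏ᵢ c_{n⌊i}(hᵢ)` for block functions `hᵢ` supported in the inner blocks (Fubini on
the torus `(ℝ/ℤ)^{n × m} ≅ ((ℝ/ℤ)ᵐ)ⁿ`, the coefficients being those of the periodisations). [folklore] -/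
theorem boxCoeff_tensorFin (h : Fin n → 𝓢(E, ℂ))
    (hsupp : ∀ i, tsupport (h i : E → ℂ) ⊆ {x | ∀ c, (Λ x) c ∈ Icc (B.l' (i, c)) (B.u' (i, c))})
    (r : Fin n → Fin m → ℤ) :
    boxCoeff (boxCoord Λ B.l B.u B.hlu) (boxShift B.l B.u) (SchwartzMap.tensorFin n h) (nnEquiv n m r) =
      ∏ i, boxCoeff (B.blockCoord Λ i) (B.blockShift i) (h i) (r i) := by
  obtain ⟨δ, hδ, hδ1, hδ2⟩ := B.exists_margin
  have hF : tsupport (SchwartzMap.tensorFin n h : (Fin n → E) → ℂ) ⊆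
      {v | ∀ ic : Fin n × Fin m, (Λ (v ic.1)) ic.2 ∈ Icc (B.l' ic) (B.u' ic)} :=
    fun v hv ic => hsupp ic.1 ((isTensorOf_tensorFin h).tsupport_subset hv ic.1) ic.2
  set G := toCube (boxCoord Λ B.l B.u B.hlu) (boxShift B.l B.u) (SchwartzMap.tensorFin n h) with hG
  set Gi : Fin n → 𝓢(EuclideanSpace ℝ (Fin m), ℂ) := fun i =>
    toCube (B.blockCoord Λ i) (B.blockShift i) (h i) with hGi
  have h0 := B.toCube_eq_zero_near_boundary Λ hδ1 hδ2 _ hF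
  have h0i := fun i => B.toCube_block_eq_zero_near_boundary Λ hδ1 hδ2 i (h i) (hsupp i)
  -- rewrite both sides as Fourier coefficients of periodic extensions
  rw [boxCoeff, ← mFourierCoeff_perExt _ hδ h0]
  have hRHS : ∀ i, boxCoeff (B.blockCoord Λ i) (B.blockShift i) (h i) (r i) =
      UnitAddTorus.mFourierCoeff (perExt (Gi i)) (r i) := fun i => by
    rw [boxCoeff, ← mFourierCoeff_perExt _ hδ (h0i i)]
  simp only [hRHS]
  -- the coefficient integrals
  set ν : Measure UnitAddCircle := AddCircle.haarAddCircle with hν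
  have hcoeff : ∀ {ι : Type} [Fintype ι] (f : UnitAddTorus ι → ℂ) (k : ι → ℤ),
      UnitAddTorus.mFourierCoeff f k =
        ∫ t, UnitAddTorus.mFourier (-k) t • f t ∂(Measure.pi fun _ : ι => ν) := fun f k => rfl
  rw [hcoeff]
  -- pointwise factorisation of the integrand
  set Φ : Fin n → UnitAddTorus (Fin m) → ℂ := fun i τ =>
    UnitAddTorus.mFourier (-(r i)) τ • perExt (Gi i) τ with hΦ
  have hpt : ∀ t : UnitAddTorus (Fin n × Fin m),
      UnitAddTorus.mFourier (-(nnEquiv n m r)) t • perExt G t =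
        ∏ i, Φ i (MeasurableEquiv.curry (Fin n) (Fin m) UnitAddCircle t i) := by
    intro t
    have hmF : UnitAddTorus.mFourier (-(nnEquiv n m r)) t =
        ∏ i, UnitAddTorus.mFourier (-(r i)) (MeasurableEquiv.curry (Fin n) (Fin m) UnitAddCircle t i) := by
      change (∏ ic : Fin n × Fin m, fourier ((-(nnEquiv n m r)) ic) (t ic)) =
        ∏ i, ∏ c, fourier ((-(r i)) c) (MeasurableEquiv.curry (Fin n) (Fin m) UnitAddCircle t i c)
      rw [Fintype.prod_prod_type]
      rfl
    have hper : perExt G t = ∏ i, perExt (Gi i) (MeasurableEquiv.curry (Fin n) (Fin m) UnitAddCircle t i) := by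
      simp only [perExt, Function.comp_apply, hG, hGi]
      rw [B.toCube_tensorFin_apply Λ]
      rfl
    rw [hmF, hper, smul_eq_mul, ← Finset.prod_mul_distrib]
    rfl
  -- Fubini: push forward along the currying map and factorise
  have hmap : (Measure.pi fun _ : Fin n × Fin m => ν).map (MeasurableEquiv.curry (Fin n) (Fin m) UnitAddCircle) =
      Measure.pi fun _ : Fin n => Measure.pi fun _ : Fin m => ν := by
    rw [← Measure.infinitePi_eq_pi, Measure.infinitePi_map_curry (fun (_ : Fin n) (_ : Fin m) => ν),
      Measure.infinitePi_eq_pi]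
    congr 1
    funext i
    rw [Measure.infinitePi_eq_pi]
  calc ∫ t, UnitAddTorus.mFourier (-(nnEquiv n m r)) t • perExt G t ∂(Measure.pi fun _ : Fin n × Fin m => ν)
      = ∫ t, ∏ i, Φ i (MeasurableEquiv.curry (Fin n) (Fin m) UnitAddCircle t i)
          ∂(Measure.pi fun _ : Fin n × Fin m => ν) := integral_congr_ae (ae_of_all _ hpt)
    _ = ∫ τ, ∏ i, Φ i (τ i) ∂((Measure.pi fun _ : Fin n × Fin m => ν).map
          (MeasurableEquiv.curry (Fin n) (Fin m) UnitAddCircle)) :=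
        (integral_map_equiv (MeasurableEquiv.curry (Fin n) (Fin m) UnitAddCircle)
          (fun τ : Fin n → UnitAddTorus (Fin m) => ∏ i, Φ i (τ i))).symm
    _ = ∏ i, ∫ τ, Φ i τ ∂(Measure.pi fun _ : Fin m => ν) := by
        rw [hmap, integral_fintype_prod_eq_prod]
    _ = ∏ i, UnitAddTorus.mFourierCoeff (perExt (Gi i)) (r i) := rfl

/-- The block-cubes `{nnEquiv r | r i ∈ [-R, R]ᵐ}` exhaust `ℤ^{n × m}`. [folklore] -/
theorem tendsto_map_piFinset_latticeCube :
    Tendsto (fun R : ℕ => (Fintype.piFinset fun _ : Fin n => latticeCube m R).map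
      (nnEquiv n m).toEmbedding) atTop atTop := by
  refine Monotone.tendsto_atTop_atTop (fun R R' h => ?_) fun s => ?_
  · exact Finset.map_subset_map.2 (Fintype.piFinset_subset _ _ fun _ =>
      Fintype.piFinset_subset _ _ fun _ => Finset.Icc_subset_Icc (by omega) (by omega))
  · obtain ⟨R, hR⟩ : ∃ R : ℕ, ∀ nn ∈ s, ∀ ic, |nn ic| ≤ R := by
      refine ⟨∑ nn ∈ s, ∑ ic, (nn ic).natAbs, fun nn hnn ic => ?_⟩
      have h1 : (nn ic).natAbs ≤ ∑ ic', (nn ic').natAbs :=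
        Finset.single_le_sum (f := fun ic' => (nn ic').natAbs) (fun _ _ => Nat.zero_le _)
          (Finset.mem_univ ic)
      have h2 : ∑ ic', (nn ic').natAbs ≤ ∑ nn' ∈ s, ∑ ic', (nn' ic').natAbs :=
        Finset.single_le_sum (f := fun nn' : Fin n × Fin m → ℤ => ∑ ic', (nn' ic').natAbs)
          (fun _ _ => Nat.zero_le _) hnn
      rw [Int.abs_eq_natAbs]
      exact_mod_cast h1.trans h2
    refine ⟨R, fun nn hnn => ?_⟩
    rw [Finset.mem_map]
    refine ⟨(nnEquiv n m).symm nn, ?_, Equiv.apply_symm_apply _ _⟩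
    refine Fintype.mem_piFinset.2 fun i => Fintype.mem_piFinset.2 fun c => Finset.mem_Icc.2 ?_
    have := abs_le.1 (hR nn hnn (i, c))
    change -(R : ℤ) ≤ nn (i, c) ∧ nn (i, c) ≤ R
    constructor <;> omega

/-- **Reproduction on tensor products.** For a continuous multilinear form `M` bounded by `s` and
block functions `hᵢ ∈ 𝓢(E, ℂ)` supported in the inner blocks of the box,
`T_B(h₁ ⊗ ⋯ ⊗ hₙ) = M(h₁, …, hₙ)`: both are the limit, along the block-cubes `R → ∞`, of
`M(∑_{k ∈ [-R,R]ᵐ} c_k(h₁) q₁(k), …) = ∑_{n} c_{n⌊1}(h₁)⋯c_{n⌊n}(hₙ) M(q(n)) = ∑ₙ cₙ(⊗h) M(q(n))`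
(one-block expansions, multilinearity, factorisation of the coefficients). [folklore] -/
theorem boxFunctional_tensorFin {s : Finset (ℕ × ℕ)} {Mc : MultilinearMap ℂ (fun _ : Fin n => 𝓢(E, ℂ)) ℂ}
    {C : ℝ} (hb : Mc.IsBoundedBySeminorms s C) (hMc : Continuous Mc) (h : Fin n → 𝓢(E, ℂ))
    (hsupp : ∀ i, tsupport (h i : E → ℂ) ⊆ {x | ∀ c, (Λ x) c ∈ Icc (B.l' (i, c)) (B.u' (i, c))}) :
    B.boxFunctional Λ hb (SchwartzMap.tensorFin n h) = Mc h := by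
  classical
  -- the block coefficients and partial sums
  set cc : Fin n → (Fin m → ℤ) → ℂ := fun i k => boxCoeff (B.blockCoord Λ i) (B.blockShift i) (h i) k
    with hcc
  set PS : ℕ → Fin n → 𝓢(E, ℂ) := fun R i =>
    ∑ k ∈ latticeCube m R, cc i k • B.charFactorS Λ (blockIdx i k) i with hPS
  -- (1) `Mc (PS R) → Mc h`
  have h1 : Tendsto (fun R => Mc (PS R)) atTop (𝓝 (Mc h)) := by
    refine (hMc.tendsto h).comp ?_
    refine tendsto_pi_nhds.2 fun i => ?_
    exact (B.tendsto_sum_blockCoeff_smul Λ i (h i) (hsupp i)).comp tendsto_latticeCube_atTop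
  -- (2) `Mc (PS R)` is a partial sum of the series of `T_B(⊗h)`
  have h2 : ∀ R : ℕ, Mc (PS R) =
      ∑ nn ∈ (Fintype.piFinset fun _ : Fin n => latticeCube m R).map (nnEquiv n m).toEmbedding,
        B.boxTerm Λ Mc (SchwartzMap.tensorFin n h) nn := by
    intro R
    rw [Finset.sum_map, hPS]
    dsimp only
    rw [MultilinearMap.map_sum_finset Mc (fun i k => cc i k • B.charFactorS Λ (blockIdx i k) i)
      (fun _ : Fin n => latticeCube m R)]
    refine Finset.sum_congr rfl fun rr _ => ?_
    rw [MultilinearMap.map_smul_univ, boxTerm, Equiv.coe_toEmbedding,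
      B.boxCoeff_tensorFin Λ h hsupp rr, smul_eq_mul]
    congr 1
    congr 1
    funext i
    exact B.charFactorS_congr Λ (by rw [block_blockIdx, block_nnEquiv])
  -- (3) the partial sums converge to `T_B(⊗h)`
  have h3 : Tendsto (fun R => Mc (PS R)) atTop (𝓝 (B.boxFunctional Λ hb (SchwartzMap.tensorFin n h))) := by
    simp only [h2]
    exact (B.hasSum_boxFunctional Λ hb (SchwartzMap.tensorFin n h)).comp
      (tendsto_map_piFinset_latticeCube (n := n) (m := m))
  exact tendsto_nhds_unique h3 h1

end BoxData

end Repr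

end Literature.MathematicalPhysics.QuantumLattice
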